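import Literature.Analysis.FluidPDE.NewtonPotentialRepresentation
import Literature.Analysis.FluidPDE.HelmholtzAnnihilator
import Literature.Analysis.FunctionSpaces.HolderAlgebra
import HarnessLib

/-!
# The Newtonian potential of a divergence-form `L^p` density

Analysis/FluidPDE support file (everything proved, no definitions) on the discharge path of the
named fact `Literature.Analysis.FluidPDE.LaplaceDivFormInteriorHolder`
(`NSBoundedSpatialHolder.lean`; Gilbarg–Trudinger 2001, Thm. 8.24 for the Laplacian: interior
Hölder continuity of weak solutions of `Δw = ∂ⱼFⱼ`, `F ∈ L^q`, `q > 3`). For a field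
`f ∈ L^p(ℝ³; ℝ³)`, `3 < p < ∞`, vanishing off a ball, the potential

  `N(x) = ∑ⱼ ∫ fⱼ(y) ∂ⱼΓ(x - y) dy`,  `∂ⱼΓ(z) = zⱼ/(4π|z|³)` (`NewtonPotentialHolder.newtonKernelGrad`),

is the solution of `ΔN = div f` that the discharge subtracts from the weak solution. This file
proves, with the exponent bookkeeping `q = p/(p-1)`, `2q < 3 < 3q`, `3/q - 2 = 1 - 3/p`:

* `abs_sum_potential_sub_le`, `abs_sum_potential_le`: the **Hölder bound**
  `|N(x) - N(z)| ≤ C(p) ‖f‖_p |x - z|^{1-3/p}` and the **sup bound**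
  `|N(x)| ≤ C(p) ρ^{1-3/p} ‖f‖_p` on `B̄(c, ρ) ⊇ supp f` (component by component from
  `NewtonPotentialHolder.abs_potential_sub_le` / `abs_potential_le`), and `continuous_sum_potential`;
* `integral_newtonKernelGrad_mul_laplacian`: **`∫ ∂ⱼΓ(x - y) Δφ(x) dx = -∂ⱼφ(y)`** for
  `φ ∈ C_c^∞` (oddness of `∂ⱼΓ`, the distributional-gradient identity
  `∫ Γ(y-x) ∂ⱼΦ = ∫ ∂ⱼΓ(y-x) Φ` of `BiotSavartNewtonKernel` with `Φ = Δφ`, `∂ⱼΔφ = Δ∂ⱼφ`, and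
  Green's representation `∫ Γ(y - x) Δψ(x) dx = ψ(y)`);
* `integral_potential_mul`: Fubini for `∫ (∫ fⱼ(y) ∂ⱼΓ(x-y) dy) ψ(x) dx` with `ψ ∈ C_c`
  (integrability on the product from `NewtonPotentialHolder.integrable_mul_kernel` and the
  uniform near-field bound `lintegral_enorm_mul_kernel_le` on the support of `ψ`);
* `integral_sum_potential_mul_laplacian`: **`ΔN = div f` in `𝓓'(ℝ³)`**, i.e.
  `∫ N Δφ = -∫ ∑ⱼ fⱼ ∂ⱼφ` for all `φ ∈ C_c^∞(ℝ³)`.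

## Mathlib / tree search

Tree (all used): `newtonKernelGrad`, `isSingularKernel_newtonKernelGrad`, `integrable_mul_kernel`,
`lintegral_enorm_mul_kernel_le`, `abs_potential_sub_le`, `abs_potential_le`
(`NewtonPotentialHolder`); `newtonKernelGrad_eq_fderiv_newtonKernel`
(`NewtonPotentialRepresentation`); `integral_newtonKernel_smul_fderiv_eq`,
`integral_newtonKernel_mul_laplacian` (`BiotSavartNewtonKernel`); `fderiv_laplacian_apply`
(`HelmholtzAnnihilator`); `contDiff_laplacian` (`NewtonKernel`), `continuous_laplacian`,
`laplacian_eq_zero_of_notMem_tsupport` (`WholeSpaceIBP`); `holderWith_of_dist_le`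
(`FunctionSpaces/HolderAlgebra`). Mathlib: `integrable_prod_iff`, `integral_integral_swap`,
`Real.HolderConjugate.conjExponent`, `MemLp.mono_exponent_of_measure_support_ne_top`,
`MemLp.eval_piLp` (components of an `L^p` field are `L^p`).

## References

* D. Gilbarg, N. S. Trudinger, *Elliptic Partial Differential Equations of Second Order*
  (2001), (2.17), Lemma 4.1–4.2 (derivatives of Newtonian potentials), Lemma 7.12 (potential
  estimates). [`GilbargTrudinger2001`]
-/

noncomputable section

open MeasureTheory Set Function Filter Topology TopologicalSpace Metric InnerProductSpace Real
open scoped ENNReal NNReal RealInnerProductSpace ContDiff Laplacian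

namespace Literature.Analysis.FluidPDE

namespace DivFormPotential

open NewtonPotentialHolder NewtonPotentialRepresentation

variable {p : ℝ}

/-! ### Exponent bookkeeping -/

/-- For `p > 3` the conjugate exponent `q = p/(p-1)` satisfies `2q < 3 < 3q` (the hypotheses of
the potential estimates for a kernel of degree `-2`) and `3/q - 2 = 1 - 3/p`. [folklore] -/
theorem conjExponent_bounds (hp : 3 < p) :
    p.HolderConjugate (p / (p - 1)) ∧ 2 * (p / (p - 1)) < 3 ∧ 3 < (2 + 1) * (p / (p - 1)) ∧
      3 / (p / (p - 1)) - 2 = 1 - 3 / p := by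
  have hp1 : (0 : ℝ) < p - 1 := by linarith
  have hp0 : (0 : ℝ) < p := by linarith
  refine ⟨Real.HolderConjugate.conjExponent (by linarith), ?_, ?_, ?_⟩
  · rw [mul_div_assoc', div_lt_iff₀ hp1]; linarith
  · rw [mul_div_assoc', lt_div_iff₀ hp1]; linarith
  · field_simp
    ring

/-- `‖g‖_p` as the `L^p` seminorm: `(∫ |g|^p)^{1/p} = eLpNorm g p`. [folklore] -/
theorem lintegral_rpow_enorm_eq_eLpNorm {G : Type*} [NormedAddCommGroup G] (hp : 0 < p)
    (g : (EuclideanSpace ℝ (Fin 3)) → G) :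
    (∫⁻ y, ‖g y‖ₑ ^ p) ^ (1 / p) = eLpNorm g (ENNReal.ofReal p) volume := by
  rw [eLpNorm_eq_lintegral_rpow_enorm_toReal (ENNReal.ofReal_pos.2 hp).ne' ENNReal.ofReal_ne_top,
    ENNReal.toReal_ofReal hp.le]

/-- An `L^p` function, `p ≥ 1`, vanishing off a ball is integrable. [folklore] -/
theorem integrable_of_memLp_of_support_subset {G : Type*} [NormedAddCommGroup G] (hp : 1 ≤ p)
    {g : (EuclideanSpace ℝ (Fin 3)) → G} (hg : MemLp g (ENNReal.ofReal p) volume)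
    {c : EuclideanSpace ℝ (Fin 3)} {ρ : ℝ} (hsupp : support g ⊆ ball c ρ) : Integrable g := by
  have h1 : MemLp g 1 volume :=
    hg.mono_exponent_of_measure_support_ne_top (s := ball c ρ)
      (fun x hx => notMem_support.1 fun h => hx (hsupp h)) measure_ball_lt_top.ne
      (ENNReal.one_le_ofReal.2 hp)
  exact memLp_one_iff_integrable.1 h1

/-- The `L^p` norm of a component is at most that of the field. [folklore] -/
theorem toReal_lintegral_apply_le (hp : 0 < p)
    {f : (EuclideanSpace ℝ (Fin 3)) → EuclideanSpace ℝ (Fin 3)}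
    (hf : MemLp f (ENNReal.ofReal p) volume) (j : Fin 3) :
    ((∫⁻ y, ‖f y j‖ₑ ^ p) ^ (1 / p)).toReal ≤ (eLpNorm f (ENNReal.ofReal p) volume).toReal := by
  rw [lintegral_rpow_enorm_eq_eLpNorm hp (fun y => f y j)]
  exact ENNReal.toReal_mono hf.eLpNorm_ne_top
    (eLpNorm_mono fun y => by simpa using PiLp.norm_apply_le (f y) j)

/-- The support of a component lies in the support of the field. [folklore] -/
theorem support_apply_subset {f : (EuclideanSpace ℝ (Fin 3)) → EuclideanSpace ℝ (Fin 3)}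
    {s : Set (EuclideanSpace ℝ (Fin 3))} (hsupp : support f ⊆ s) (j : Fin 3) :
    support (fun y => f y j) ⊆ s := by
  intro y hy
  refine hsupp ?_
  rw [mem_support] at hy ⊢
  intro h
  exact hy (by simp [h])

/-! ### The kernel `∂ⱼΓ` against a Laplacian -/

/-- `∂ⱼΓ` is odd. [folklore] -/
theorem newtonKernelGrad_neg (j : Fin 3) (z : EuclideanSpace ℝ (Fin 3)) :
    newtonKernelGrad j (-z) = -newtonKernelGrad j z := by
  simp [newtonKernelGrad, inner_neg_left, norm_neg, neg_div]

/-- The Laplacian of a test function has compact support. [folklore] -/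
theorem hasCompactSupport_laplacian {φ : (EuclideanSpace ℝ (Fin 3)) → ℝ}
    (hφc : HasCompactSupport φ) : HasCompactSupport (Δ φ) :=
  hφc.mono' fun x hx => by
    by_contra h
    exact hx (laplacian_eq_zero_of_notMem_tsupport h)

/-- **`∫ ∂ⱼΓ(x - y) Δφ(x) dx = -∂ⱼφ(y)`** for `φ ∈ C_c^∞(ℝ³)`: by oddness this is
`-∫ ∂ⱼΓ(y - x) Δφ(x) dx = -∫ Γ(y - x) ∂ⱼΔφ(x) dx = -∫ Γ(y - x) Δ(∂ⱼφ)(x) dx = -∂ⱼφ(y)`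
(Gilbarg–Trudinger, Lemma 4.1 and (2.17)). [cite: GilbargTrudinger2001, Lemma 4.1 with (2.17)] -/
theorem integral_newtonKernelGrad_mul_laplacian {φ : (EuclideanSpace ℝ (Fin 3)) → ℝ}
    (hφ : ContDiff ℝ ∞ φ) (hφc : HasCompactSupport φ) (j : Fin 3) (y : EuclideanSpace ℝ (Fin 3)) :
    ∫ x, newtonKernelGrad j (x - y) * (Δ φ) x =
      -fderiv ℝ φ y (EuclideanSpace.single j (1 : ℝ)) := by
  have hφ3 : ContDiff ℝ 3 φ := hφ.of_le (by norm_cast)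
  have hΔ1 : ContDiff ℝ 1 (Δ φ) := contDiff_laplacian (hφ.of_le (by norm_cast))
  have hΔc : HasCompactSupport (Δ φ) := hasCompactSupport_laplacian hφc
  have hψ2 : ContDiff ℝ 2 fun w => fderiv ℝ φ w (EuclideanSpace.single j (1 : ℝ)) :=
    (hφ.fderiv_right (m := 2) (by norm_cast)).clm_apply contDiff_const
  have hψc : HasCompactSupport fun w => fderiv ℝ φ w (EuclideanSpace.single j (1 : ℝ)) :=
    hφc.fderiv_apply (𝕜 := ℝ) _
  have h1 : ∀ x, newtonKernelGrad j (x - y) * (Δ φ) x =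
      -(fderiv ℝ newtonKernel (y - x) (EuclideanSpace.single j (1 : ℝ)) * (Δ φ) x) := by
    intro x
    rw [← newtonKernelGrad_eq_fderiv_newtonKernel, show x - y = -(y - x) by abel,
      newtonKernelGrad_neg]
    ring
  simp_rw [h1, integral_neg]
  rw [neg_inj]
  have h2 := integral_newtonKernel_smul_fderiv_eq (F := ℝ) hΔ1 hΔc y
    (EuclideanSpace.single j (1 : ℝ))
  simp only [smul_eq_mul] at h2
  rw [← h2]
  have h3 : ∀ x, fderiv ℝ (Δ φ) x (EuclideanSpace.single j (1 : ℝ)) =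
      (Δ (fun w => fderiv ℝ φ w (EuclideanSpace.single j (1 : ℝ)))) x := fun x =>
    fderiv_laplacian_apply hφ3 x _
  simp_rw [h3]
  exact integral_newtonKernel_mul_laplacian hψ2 hψc y

/-! ### Fubini for the potential of one component against a test function -/

section OneComponent

variable {g : (EuclideanSpace ℝ (Fin 3)) → ℝ} {c : EuclideanSpace ℝ (Fin 3)} {ρ : ℝ}
  {ψ : (EuclideanSpace ℝ (Fin 3)) → ℝ}

/-- **Integrability on the product** of `(x, y) ↦ g(y) ∂ⱼΓ(x - y) ψ(x)` for `g ∈ L^p`, `p > 3`,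
vanishing off a ball and `ψ ∈ C_c`: the `y`-sections converge absolutely
(`integrable_mul_kernel`) and `x ↦ ∫ |g(y)| |∂ⱼΓ(x - y)| dy` is bounded on the support of `ψ`
(`lintegral_enorm_mul_kernel_le` with a radius uniform over that support). [folklore] -/
theorem integrable_uncurry (hp : 3 < p) (hg : MemLp g (ENNReal.ofReal p) volume)
    (hsupp : support g ⊆ ball c ρ) (hψ : Continuous ψ) (hψc : HasCompactSupport ψ) (j : Fin 3) :
    Integrable (uncurry fun x y => g y * newtonKernelGrad j (x - y) * ψ x)
      (volume.prod volume) := by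
  obtain ⟨hpq, h2q, -, -⟩ := conjExponent_bounds hp
  have hk := isSingularKernel_newtonKernelGrad j
  have hA : (0 : ℝ) ≤ (4 * π)⁻¹ := by positivity
  have hp0 : 0 < p := by linarith
  -- measurability on the product
  have hm : AEStronglyMeasurable (uncurry fun x y => g y * newtonKernelGrad j (x - y) * ψ x)
      (volume.prod volume) := by
    refine ((hg.1.comp_snd).mul ?_).mul (hψ.comp continuous_fst).aestronglyMeasurable
    exact ((measurable_newtonKernelGrad j).comp
      (measurable_fst.sub measurable_snd)).aestronglyMeasurable
  rw [integrable_prod_iff hm]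
  refine ⟨Eventually.of_forall fun x => ?_, ?_⟩
  · exact (integrable_mul_kernel hk hA hpq h2q hg hsupp x).mul_const (ψ x)
  -- a radius `R'` with `B(c, ρ) ⊆ B(x, R')` for every `x` in the support of `ψ`
  obtain ⟨Rψ, hRψ⟩ : ∃ Rψ : ℝ, tsupport ψ ⊆ closedBall (0 : EuclideanSpace ℝ (Fin 3)) Rψ :=
    hψc.isCompact.isBounded.subset_closedBall 0
  set R' : ℝ := |ρ| + ‖c‖ + |Rψ| + 1 with hR'
  have hR'0 : 0 < R' := by positivity
  have hball : ∀ x ∈ tsupport ψ, ball c ρ ⊆ ball x R' := by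
    intro x hx z hz
    have hxn : ‖x‖ ≤ Rψ := mem_closedBall_zero_iff.1 (hRψ hx)
    rw [mem_ball] at hz ⊢
    calc dist z x ≤ dist z c + dist c x := dist_triangle _ _ _
      _ ≤ dist z c + (‖c‖ + ‖x‖) := by rw [dist_eq_norm c x]; linarith [norm_sub_le c x]
      _ < R' := by rw [hR']; linarith [le_abs_self ρ, le_abs_self Rψ]
  -- the constants
  set q : ℝ := p / (p - 1) with hq
  set Cq : ℝ≥0∞ := (ENNReal.ofReal ((4 * π)⁻¹ ^ q *
    (3 * (volume : Measure (EuclideanSpace ℝ (Fin 3))).real (ball 0 1) *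
      (R' ^ (3 - 2 * q) / (3 - 2 * q))))) ^ (1 / q) with hCq
  set Np : ℝ≥0∞ := (∫⁻ y, ‖g y‖ₑ ^ p) ^ (1 / p) with hNp
  have hNp_top : Np ≠ ⊤ := by
    rw [hNp, lintegral_rpow_enorm_eq_eLpNorm hp0]
    exact hg.eLpNorm_ne_top
  have hCq_top : Cq ≠ ⊤ :=
    ENNReal.rpow_ne_top_of_nonneg (one_div_nonneg.2 hpq.symm.nonneg) ENNReal.ofReal_ne_top
  set M : ℝ := (Np * Cq).toReal with hM
  -- the bound for the norm integral
  have hbound : ∀ x, ∫ y, ‖g y * newtonKernelGrad j (x - y) * ψ x‖ ≤ M * |ψ x| := by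
    intro x
    by_cases hx : x ∈ tsupport ψ
    · have hle := lintegral_enorm_mul_kernel_le hk hA hpq h2q hg.1 hR'0
        (hsupp.trans (hball x hx))
      have hfi : Integrable fun y => ‖g y‖ * ‖newtonKernelGrad j (x - y)‖ := by
        refine (integrable_mul_kernel hk hA hpq h2q hg hsupp x).norm.congr
          (Eventually.of_forall fun y => ?_)
        exact norm_mul _ _
      have heq : ∫ y, ‖g y * newtonKernelGrad j (x - y) * ψ x‖ =
          (∫ y, ‖g y‖ * ‖newtonKernelGrad j (x - y)‖) * |ψ x| := by
        rw [← integral_mul_const]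
        refine integral_congr_ae (Eventually.of_forall fun y => ?_)
        simp only [norm_mul, Real.norm_eq_abs]
      rw [heq]
      refine mul_le_mul_of_nonneg_right ?_ (abs_nonneg _)
      rw [integral_eq_lintegral_of_nonneg_ae (Eventually.of_forall fun y => by positivity)
        hfi.aestronglyMeasurable, hM]
      refine ENNReal.toReal_mono (ENNReal.mul_ne_top hNp_top hCq_top) (le_trans (le_of_eq ?_) hle)
      refine lintegral_congr fun y => ?_
      rw [ENNReal.ofReal_mul (norm_nonneg _), ofReal_norm, ofReal_norm]
    · have h0 : ψ x = 0 := image_eq_zero_of_notMem_tsupport hx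
      simp [h0]
  refine Integrable.mono' ((hψ.integrable_of_hasCompactSupport hψc).abs.const_mul M)
    hm.norm.integral_prod_right' (Eventually.of_forall fun x => ?_)
  rw [Real.norm_eq_abs, abs_of_nonneg (integral_nonneg fun y => norm_nonneg _)]
  exact hbound x

/-- The potential of one component against `ψ ∈ C_c` is integrable. [folklore] -/
theorem integrable_potential_mul (hp : 3 < p) (hg : MemLp g (ENNReal.ofReal p) volume)
    (hsupp : support g ⊆ ball c ρ) (hψ : Continuous ψ) (hψc : HasCompactSupport ψ) (j : Fin 3) :
    Integrable fun x => (∫ y, g y * newtonKernelGrad j (x - y)) * ψ x := by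
  refine ((integrable_uncurry hp hg hsupp hψ hψc j).integral_prod_left).congr
    (Eventually.of_forall fun x => ?_)
  simp only [uncurry_apply_pair]
  rw [← integral_mul_const]

/-- **Fubini**: `∫ (∫ g(y) ∂ⱼΓ(x - y) dy) ψ(x) dx = ∫ g(y) (∫ ∂ⱼΓ(x - y) ψ(x) dx) dy` for `g ∈ L^p`,
`p > 3`, vanishing off a ball and `ψ ∈ C_c`. [folklore] -/
theorem integral_potential_mul (hp : 3 < p) (hg : MemLp g (ENNReal.ofReal p) volume)
    (hsupp : support g ⊆ ball c ρ) (hψ : Continuous ψ) (hψc : HasCompactSupport ψ) (j : Fin 3) :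
    ∫ x, (∫ y, g y * newtonKernelGrad j (x - y)) * ψ x =
      ∫ y, g y * ∫ x, newtonKernelGrad j (x - y) * ψ x := by
  have hI := integrable_uncurry hp hg hsupp hψ hψc j
  have h1 : ∀ x, (∫ y, g y * newtonKernelGrad j (x - y)) * ψ x =
      ∫ y, g y * newtonKernelGrad j (x - y) * ψ x := fun x => by
    rw [← integral_mul_const]
  have h2 : ∀ y, g y * ∫ x, newtonKernelGrad j (x - y) * ψ x =
      ∫ x, g y * newtonKernelGrad j (x - y) * ψ x := fun y => by
    rw [← integral_const_mul]
    refine integral_congr_ae (Eventually.of_forall fun x => ?_)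
    ring
  simp_rw [h1, h2]
  exact integral_integral_swap hI

end OneComponent

/-! ### `ΔN = div f` in the sense of distributions -/

/-- **`ΔN = div f` weakly**: for `f ∈ L^p(ℝ³; ℝ³)`, `p > 3`, vanishing off a ball and every
`φ ∈ C_c^∞(ℝ³)`, `∫ N Δφ = -∫ ∑ⱼ fⱼ ∂ⱼφ`, where `N(x) = ∑ⱼ ∫ fⱼ(y) ∂ⱼΓ(x - y) dy`
(component-wise Fubini and `∫ ∂ⱼΓ(x - y) Δφ(x) dx = -∂ⱼφ(y)`; Gilbarg–Trudinger, Lemma 4.2 in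
distributional form). [cite: GilbargTrudinger2001, Lemma 4.2 (distributional form, via Lemma 4.1 and (2.17))] -/
theorem integral_sum_potential_mul_laplacian (hp : 3 < p)
    {f : (EuclideanSpace ℝ (Fin 3)) → EuclideanSpace ℝ (Fin 3)}
    (hf : MemLp f (ENNReal.ofReal p) volume) {c : EuclideanSpace ℝ (Fin 3)} {ρ : ℝ}
    (hsupp : support f ⊆ ball c ρ) {φ : (EuclideanSpace ℝ (Fin 3)) → ℝ} (hφ : ContDiff ℝ ∞ φ)
    (hφc : HasCompactSupport φ) :
    ∫ x, (∑ j, ∫ y, f y j * newtonKernelGrad j (x - y)) * (Δ φ) x =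
      -∫ y, ∑ j, f y j * fderiv ℝ φ y (EuclideanSpace.single j (1 : ℝ)) := by
  have hfj : ∀ j, MemLp (fun y => f y j) (ENNReal.ofReal p) volume := hf.eval_piLp
  have hsj : ∀ j, support (fun y => f y j) ⊆ ball c ρ := support_apply_subset hsupp
  have hΔ : Continuous (Δ φ) := continuous_laplacian (hφ.of_le (by norm_cast))
  have hΔc : HasCompactSupport (Δ φ) := hasCompactSupport_laplacian hφc
  have hI : ∀ j, Integrable fun x => (∫ y, f y j * newtonKernelGrad j (x - y)) * (Δ φ) x :=
    fun j => integrable_potential_mul hp (hfj j) (hsj j) hΔ hΔc j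
  have hsum : ∀ x, (∑ j, ∫ y, f y j * newtonKernelGrad j (x - y)) * (Δ φ) x =
      ∑ j, (∫ y, f y j * newtonKernelGrad j (x - y)) * (Δ φ) x := fun x => Finset.sum_mul _ _ _
  simp_rw [hsum]
  rw [integral_finsetSum _ fun j _ => hI j]
  simp_rw [integral_potential_mul hp (hfj _) (hsj _) hΔ hΔc,
    integral_newtonKernelGrad_mul_laplacian hφ hφc]
  -- `∑ⱼ ∫ fⱼ (-∂ⱼφ) = -∫ ∑ⱼ fⱼ ∂ⱼφ`
  have hdφ : ∀ j, Continuous fun y => fderiv ℝ φ y (EuclideanSpace.single j (1 : ℝ)) := fun j =>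
    (hφ.continuous_fderiv (by simp)).clm_apply continuous_const
  have hdφc : ∀ j, HasCompactSupport fun y => fderiv ℝ φ y (EuclideanSpace.single j (1 : ℝ)) :=
    fun j => hφc.fderiv_apply (𝕜 := ℝ) _
  have hIj : ∀ j, Integrable fun y => f y j * fderiv ℝ φ y (EuclideanSpace.single j (1 : ℝ)) := by
    intro j
    obtain ⟨C, hC⟩ := (hdφ j).bounded_above_of_compact_support (hdφc j)
    exact (integrable_of_memLp_of_support_subset (by linarith) (hfj j) (hsj j)).mul_bdd
      (hdφ j).aestronglyMeasurable (Eventually.of_forall hC)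
  rw [integral_finsetSum _ fun j _ => hIj j, ← Finset.sum_neg_distrib]
  refine Finset.sum_congr rfl fun j _ => ?_
  rw [← integral_neg]
  refine integral_congr_ae (Eventually.of_forall fun y => ?_)
  ring

/-! ### Hölder and sup bounds for the potential -/

/-- **Hölder bound for the potential of a divergence-form density**: there is `C = C(p)` such
that `|N(x) - N(z)| ≤ C ‖f‖_p |x - z|^{1 - 3/p}` for every `f ∈ L^p(ℝ³; ℝ³)`, `p > 3`, vanishing
off a ball (`NewtonPotentialHolder.abs_potential_sub_le` for the kernel `∂ⱼΓ` of degree `-2`,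
summed over the components; Gilbarg–Trudinger, Lemma 7.12 / Thm. 7.17 type estimate).
[folklore] -/
theorem abs_sum_potential_sub_le (hp : 3 < p) :
    ∃ C : ℝ, 0 ≤ C ∧ ∀ (f : (EuclideanSpace ℝ (Fin 3)) → EuclideanSpace ℝ (Fin 3))
      (c : EuclideanSpace ℝ (Fin 3)) (ρ : ℝ), MemLp f (ENNReal.ofReal p) volume →
      support f ⊆ ball c ρ → ∀ x z : EuclideanSpace ℝ (Fin 3),
        |(∑ j, ∫ y, f y j * newtonKernelGrad j (x - y)) -
            ∑ j, ∫ y, f y j * newtonKernelGrad j (z - y)| ≤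
          C * (eLpNorm f (ENNReal.ofReal p) volume).toReal * ‖x - z‖ ^ (1 - 3 / p) := by
  obtain ⟨hpq, h2q, h3q, hα⟩ := conjExponent_bounds hp
  have hp0 : 0 < p := by linarith
  set q : ℝ := p / (p - 1) with hq
  set C₀ : ℝ := (4 * π)⁻¹ *
      (3 * (volume : Measure (EuclideanSpace ℝ (Fin 3))).real (ball 0 1) / (3 - 2 * q)) ^ (1 / q) *
        ((2 : ℝ) ^ (1 - 3 / p) + (3 : ℝ) ^ (1 - 3 / p)) +
      8 / π * (3 * (volume : Measure (EuclideanSpace ℝ (Fin 3))).real (ball 0 1) /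
        ((2 + 1) * q - 3)) ^ (1 / q) * (2 : ℝ) ^ (1 - 3 / p - 1) with hC₀
  refine ⟨3 * max C₀ 0, by positivity, fun f c ρ hf hsupp x z => ?_⟩
  have hfj : ∀ j, MemLp (fun y => f y j) (ENNReal.ofReal p) volume := hf.eval_piLp
  have hsj : ∀ j, support (fun y => f y j) ⊆ ball c ρ := support_apply_subset hsupp
  set S : ℝ := (eLpNorm f (ENNReal.ofReal p) volume).toReal with hS
  have hS0 : 0 ≤ S := ENNReal.toReal_nonneg
  have hj : ∀ j, |(∫ y, f y j * newtonKernelGrad j (x - y)) - ∫ y, f y j * newtonKernelGrad j (z - y)|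
      ≤ max C₀ 0 * S * ‖x - z‖ ^ (1 - 3 / p) := by
    intro j
    have h := abs_potential_sub_le (isSingularKernel_newtonKernelGrad j) (by positivity)
      (by positivity) hpq h2q h3q (hfj j) (hsj j) x z
    rw [hα] at h
    have h' : |(∫ y, f y j * newtonKernelGrad j (x - y)) - ∫ y, f y j * newtonKernelGrad j (z - y)|
        ≤ C₀ * ((∫⁻ y, ‖f y j‖ₑ ^ p) ^ (1 / p)).toReal * ‖x - z‖ ^ (1 - 3 / p) := h
    refine h'.trans ?_
    have hn := toReal_lintegral_apply_le hp0 hf j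
    have hr : 0 ≤ ‖x - z‖ ^ (1 - 3 / p) := by positivity
    have h1 : C₀ * ((∫⁻ y, ‖f y j‖ₑ ^ p) ^ (1 / p)).toReal * ‖x - z‖ ^ (1 - 3 / p) ≤
        max C₀ 0 * ((∫⁻ y, ‖f y j‖ₑ ^ p) ^ (1 / p)).toReal * ‖x - z‖ ^ (1 - 3 / p) :=
      mul_le_mul_of_nonneg_right
        (mul_le_mul_of_nonneg_right (le_max_left _ _) ENNReal.toReal_nonneg) hr
    refine h1.trans ?_
    exact mul_le_mul_of_nonneg_right
      (mul_le_mul_of_nonneg_left hn (le_max_right _ _)) hr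
  rw [← Finset.sum_sub_distrib]
  refine (Finset.abs_sum_le_sum_abs _ _).trans ?_
  calc ∑ j, |(∫ y, f y j * newtonKernelGrad j (x - y)) - ∫ y, f y j * newtonKernelGrad j (z - y)|
      ≤ ∑ _j : Fin 3, max C₀ 0 * S * ‖x - z‖ ^ (1 - 3 / p) := Finset.sum_le_sum fun j _ => hj j
    _ = 3 * max C₀ 0 * S * ‖x - z‖ ^ (1 - 3 / p) := by simp; ring

/-- **Sup bound for the potential of a divergence-form density**: there is `C = C(p)` such that
`|N(x)| ≤ C ρ^{1 - 3/p} ‖f‖_p` for `x ∈ B̄(c, ρ)` whenever `f ∈ L^p(ℝ³; ℝ³)`, `p > 3`, vanishes off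
`B(c, ρ)` (`NewtonPotentialHolder.abs_potential_le`, summed over the components). [folklore] -/
theorem abs_sum_potential_le (hp : 3 < p) :
    ∃ C : ℝ, 0 ≤ C ∧ ∀ (f : (EuclideanSpace ℝ (Fin 3)) → EuclideanSpace ℝ (Fin 3))
      (c : EuclideanSpace ℝ (Fin 3)) (ρ : ℝ), 0 < ρ → MemLp f (ENNReal.ofReal p) volume →
      support f ⊆ ball c ρ → ∀ x ∈ closedBall c ρ,
        |∑ j, ∫ y, f y j * newtonKernelGrad j (x - y)| ≤
          C * ρ ^ (1 - 3 / p) * (eLpNorm f (ENNReal.ofReal p) volume).toReal := by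
  obtain ⟨hpq, h2q, -, hα⟩ := conjExponent_bounds hp
  have hp0 : 0 < p := by linarith
  set q : ℝ := p / (p - 1) with hq
  set C₀ : ℝ := (4 * π)⁻¹ *
    (3 * (volume : Measure (EuclideanSpace ℝ (Fin 3))).real (ball 0 1) / (3 - 2 * q)) ^ (1 / q) *
      (2 : ℝ) ^ (1 - 3 / p) with hC₀
  refine ⟨3 * max C₀ 0, by positivity, fun f c ρ hρ hf hsupp x hx => ?_⟩
  have hfj : ∀ j, MemLp (fun y => f y j) (ENNReal.ofReal p) volume := hf.eval_piLp
  have hsj : ∀ j, support (fun y => f y j) ⊆ ball c ρ := support_apply_subset hsupp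
  set S : ℝ := (eLpNorm f (ENNReal.ofReal p) volume).toReal with hS
  have hS0 : 0 ≤ S := ENNReal.toReal_nonneg
  have hj : ∀ j, |∫ y, f y j * newtonKernelGrad j (x - y)| ≤ max C₀ 0 * ρ ^ (1 - 3 / p) * S := by
    intro j
    have h := abs_potential_le (isSingularKernel_newtonKernelGrad j) (by positivity) hpq h2q
      (hfj j) hρ (hsj j) hx
    rw [hα, Real.mul_rpow (by norm_num) hρ.le] at h
    refine h.trans ?_
    have hn := toReal_lintegral_apply_le hp0 hf j
    have hr : 0 ≤ ρ ^ (1 - 3 / p) := by positivity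
    calc (4 * π)⁻¹ * (3 * (volume : Measure (EuclideanSpace ℝ (Fin 3))).real (ball 0 1) /
          (3 - 2 * q)) ^ (1 / q) * ((2 : ℝ) ^ (1 - 3 / p) * ρ ^ (1 - 3 / p)) *
          ((∫⁻ y, ‖f y j‖ₑ ^ p) ^ (1 / p)).toReal
        = C₀ * ρ ^ (1 - 3 / p) * ((∫⁻ y, ‖f y j‖ₑ ^ p) ^ (1 / p)).toReal := by
          rw [hC₀]; ring
      _ ≤ max C₀ 0 * ρ ^ (1 - 3 / p) * ((∫⁻ y, ‖f y j‖ₑ ^ p) ^ (1 / p)).toReal :=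
          mul_le_mul_of_nonneg_right
            (mul_le_mul_of_nonneg_right (le_max_left _ _) hr) ENNReal.toReal_nonneg
      _ ≤ max C₀ 0 * ρ ^ (1 - 3 / p) * S :=
          mul_le_mul_of_nonneg_left hn (mul_nonneg (le_max_right _ _) hr)
  refine (Finset.abs_sum_le_sum_abs _ _).trans ?_
  calc ∑ j, |∫ y, f y j * newtonKernelGrad j (x - y)|
      ≤ ∑ _j : Fin 3, max C₀ 0 * ρ ^ (1 - 3 / p) * S := Finset.sum_le_sum fun j _ => hj j
    _ = 3 * max C₀ 0 * ρ ^ (1 - 3 / p) * S := by simp; ring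

/-- The potential of a divergence-form `L^p` density, `p > 3`, is continuous (indeed Hölder).
[folklore] -/
theorem continuous_sum_potential (hp : 3 < p)
    {f : (EuclideanSpace ℝ (Fin 3)) → EuclideanSpace ℝ (Fin 3)}
    (hf : MemLp f (ENNReal.ofReal p) volume) {c : EuclideanSpace ℝ (Fin 3)} {ρ : ℝ}
    (hsupp : support f ⊆ ball c ρ) :
    Continuous fun x => ∑ j, ∫ y, f y j * newtonKernelGrad j (x - y) := by
  obtain ⟨C, hC0, hC⟩ := abs_sum_potential_sub_le hp
  have hα : 0 < 1 - 3 / p := by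
    rw [sub_pos, div_lt_one (by linarith)]; exact hp
  set L : ℝ≥0 := (C * (eLpNorm f (ENNReal.ofReal p) volume).toReal).toNNReal with hL
  set r : ℝ≥0 := (1 - 3 / p).toNNReal with hr
  have hrr : (r : ℝ) = 1 - 3 / p := Real.coe_toNNReal _ hα.le
  have hH : HolderWith L r fun x => ∑ j, ∫ y, f y j * newtonKernelGrad j (x - y) := by
    refine FunctionSpaces.holderWith_of_dist_le fun x z => ?_
    rw [Real.dist_eq, dist_eq_norm, hrr, hL, Real.coe_toNNReal _ (by positivity)]
    exact hC f c ρ hf hsupp x z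
  exact hH.continuous (Real.toNNReal_pos.2 hα)

end DivFormPotential

end Literature.Analysis.FluidPDE
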